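import Summits.QuantumFields.YangMills.Theorems.ColdStartUniversalityLatticeLangevinWilsonSemigroupPoincareSmoothing
import HarnessLib

/-!
# Route `ColdStartUniversality` (fixed-cut-off `L²(μ_{β'})` package): DISCRETE LOG-CONVEXITY of the stationary autocorrelation
# function of the reversible SZZ dynamics and Riemann lower sums — tools for «uniform `τ_int` bound ⇒ spectral gap»

Helper file (seat `ym-line-csu-p1`, g17; `--supports stmt-QuantumFields-27363`), first half of the fourth part of the semigroup-form
Poincaré package (sequel: `…WilsonAutocorrelationToGap`).  For continuous `F` put `Φ_F(u) = ∫ F κ_u F dμ_{β'}` (non-negative,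
non-increasing, midpoint log-convex: g15 `sq_integral_mul_transition_le`, `integral_mul_transition_self_antitone`).

* `dirichletScale_eq_centred` — `∫ G² dμ − ∫ G κ_h G dμ = Φ_{G₀}(0) − Φ_{G₀}(h)` with `G₀ = G − μG` (centring the semigroup Dirichlet form).
* ★ `integral_mul_transition_succ_ratio` — DISCRETE LOG-CONVEXITY on a grid: `Φ((n+1)T)² ≤ Φ(nT) Φ((n+2)T)`.
* ★ `integral_mul_transition_nat_mul_ge` — THE FIRST RATIO IS THE SMALLEST: `Φ(nT) ≥ Φ(0) (Φ(T)/Φ(0))^n` when `Φ(0) > 0`.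
* `mul_sum_le_intervalIntegral_autocorrelation` — Riemann lower sum of the antitone `Φ`: `T Σ_{k<N} Φ((k+1)T) ≤ ∫₀^{NT} Φ(t) dt`.

THEOREMS ONLY, no definition, no sorry.  HONEST FRAMING: RECORD-rung R3 plumbing at FIXED cut-off; nothing K-uniform is proved; no
crux, rung or summit statement is proved; the Yang–Mills mass gap is NOT proved.
-/

set_option autoImplicit false

noncomputable section

namespace Summit.QuantumFields.YangMills.Theorems.ColdStartUniversality

open MeasureTheory ProbabilityTheory Filter Set Topology Finset
open scoped BigOperators NNReal ENNReal
open Literature.Probability.Process Literature.MathematicalPhysics.QuantumFieldTheory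
open Literature.MathematicalPhysics.QuantumLattice (fundamentalRep fundamentalLatticeRep continuous_fundamentalRep)

variable {L : ℕ} [NeZero L]

/-! ## §1. Centring, discrete log-convexity, Riemann lower sums -/

/-- **Centring the semigroup Dirichlet form**: `∫ G² dμ − ∫ G κ_h G dμ = ∫ G₀² dμ − ∫ G₀ κ_h G₀ dμ` with `G₀ = G − μG`
(`κ_h 1 = 1` and the invariance `∫ κ_h G₀ dμ = ∫ G₀ dμ = 0`). [folklore] -/
theorem dirichletScale_eq_centred (L : ℕ) [NeZero L] (β' : ℝ)
    (κ : ℝ≥0 → Kernel (GaugeConfig 3 L (Matrix.specialUnitaryGroup (Fin 2) ℂ))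
      (GaugeConfig 3 L (Matrix.specialUnitaryGroup (Fin 2) ℂ))) [∀ t, IsMarkovKernel (κ t)]
    (hreal : ∀ (t : ℝ≥0) (x : GaugeConfig 3 L (Matrix.specialUnitaryGroup (Fin 2) ℂ))
        (Ω : Type) [MeasurableSpace Ω] (P : Measure Ω) [IsProbabilityMeasure P]
        (W : ℝ≥0 → Ω → (Edge 3 L × NoiseIdx 2 → ℝ)) (hW : IsFlatBrownian W P)
        (U : ℝ≥0 → Ω → GaugeConfig 3 L (Matrix.specialUnitaryGroup (Fin 2) ℂ)),
        (∀ ω, U 0 ω = x) →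
        (latticeLangevinDynamics (fundamentalLatticeRep 2) β').IsSolution (fundamentalRep (Fin 2))
          hW.natFiltration P W U →
        κ t x = P.map (U t))
    (h : ℝ≥0) {G : GaugeConfig 3 L (Matrix.specialUnitaryGroup (Fin 2) ℂ) → ℝ} (hG : Continuous G) :
    (∫ x, G x * G x ∂(wilsonMeasure (d := 3) (L := L) (fundamentalRep (Fin 2)) β')) -
        ∫ x, G x * (∫ y, G y ∂(κ h x)) ∂(wilsonMeasure (d := 3) (L := L) (fundamentalRep (Fin 2)) β') =
      (∫ x, (G x - ∫ z, G z ∂(wilsonMeasure (d := 3) (L := L) (fundamentalRep (Fin 2)) β')) *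
          (G x - ∫ z, G z ∂(wilsonMeasure (d := 3) (L := L) (fundamentalRep (Fin 2)) β'))
          ∂(wilsonMeasure (d := 3) (L := L) (fundamentalRep (Fin 2)) β')) -
        ∫ x, (G x - ∫ z, G z ∂(wilsonMeasure (d := 3) (L := L) (fundamentalRep (Fin 2)) β')) *
          (∫ y, (G y - ∫ z, G z ∂(wilsonMeasure (d := 3) (L := L) (fundamentalRep (Fin 2)) β')) ∂(κ h x))
          ∂(wilsonMeasure (d := 3) (L := L) (fundamentalRep (Fin 2)) β') := by
  classical
  haveI := secondCountableTopology_su2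
  haveI := borelSpace_config L
  set μ : Measure (GaugeConfig 3 L (Matrix.specialUnitaryGroup (Fin 2) ℂ)) :=
    wilsonMeasure (d := 3) (L := L) (fundamentalRep (Fin 2)) β' with hμ
  haveI : IsProbabilityMeasure μ :=
    isProbabilityMeasure_wilsonMeasure (d := 3) (L := L) (fundamentalRep (Fin 2)) (continuous_fundamentalRep (Fin 2)) β'
  set m : ℝ := ∫ z, G z ∂μ with hm
  set G₀ : GaugeConfig 3 L (Matrix.specialUnitaryGroup (Fin 2) ℂ) → ℝ := fun x => G x - m with hG₀
  have hG₀c : Continuous G₀ := hG.sub continuous_const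
  obtain ⟨M, hM0, hM⟩ := exists_abs_le_of_continuous hG
  obtain ⟨M₀, hM₀0, hM₀⟩ := exists_abs_le_of_continuous hG₀c
  have hGi : ∀ (ν : Measure (GaugeConfig 3 L (Matrix.specialUnitaryGroup (Fin 2) ℂ))) [IsProbabilityMeasure ν],
      Integrable G ν := fun ν _ =>
    Integrable.of_bound hG.aestronglyMeasurable M (Eventually.of_forall fun z => by rw [Real.norm_eq_abs]; exact hM z)
  have hκG₀ : ∀ x, ∫ y, G₀ y ∂(κ h x) = (∫ y, G y ∂(κ h x)) - m := by
    intro x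
    simp only [hG₀]
    rw [integral_sub (hGi _) (integrable_const m), integral_const, probReal_univ, one_smul]
  have hG₀0 : ∫ x, G₀ x ∂μ = 0 := by
    simp only [hG₀]
    rw [integral_sub (hGi _) (integrable_const m), integral_const, probReal_univ, one_smul, hm, sub_self]
  have hκG₀0 : ∫ x, (∫ y, G₀ y ∂(κ h x)) ∂μ = 0 := by
    rw [integral_transitionKernel_integral_eq_wilson (L := L) β' κ hreal h hG₀c.measurable ⟨M₀, hM₀⟩]
    exact hG₀0
  have hκGc : Continuous fun x => ∫ y, G y ∂(κ h x) := continuous_integral_transitionKernel L β' κ hreal h hG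
  have hκG₀c : Continuous fun x => ∫ y, G₀ y ∂(κ h x) := continuous_integral_transitionKernel L β' κ hreal h hG₀c
  have hi1 : Integrable (fun x => G x * G x) μ := integrable_of_continuous_of_compactSpace (hG.mul hG) μ
  have hi2 : Integrable (fun x => G x * (∫ y, G y ∂(κ h x))) μ :=
    integrable_of_continuous_of_compactSpace (hG.mul hκGc) μ
  have hi3 : Integrable (fun x => G₀ x * G₀ x) μ := integrable_of_continuous_of_compactSpace (hG₀c.mul hG₀c) μ
  have hi4 : Integrable (fun x => G₀ x * (∫ y, G₀ y ∂(κ h x))) μ :=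
    integrable_of_continuous_of_compactSpace (hG₀c.mul hκG₀c) μ
  show (∫ x, G x * G x ∂μ) - ∫ x, G x * (∫ y, G y ∂(κ h x)) ∂μ =
    (∫ x, G₀ x * G₀ x ∂μ) - ∫ x, G₀ x * (∫ y, G₀ y ∂(κ h x)) ∂μ
  rw [← integral_sub hi1 hi2, ← integral_sub hi3 hi4]
  have e : ∀ x, G x * G x - G x * (∫ y, G y ∂(κ h x)) =
      (G₀ x * G₀ x - G₀ x * (∫ y, G₀ y ∂(κ h x))) + m * (G₀ x - ∫ y, G₀ y ∂(κ h x)) := by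
    intro x; rw [hκG₀ x]; simp only [hG₀]; ring
  simp_rw [e]
  have hi5 : Integrable (fun x => m * (G₀ x - ∫ y, G₀ y ∂(κ h x))) μ :=
    (integrable_of_continuous_of_compactSpace (hG₀c.sub hκG₀c) μ).const_mul m
  have hi34 : Integrable (fun x => G₀ x * G₀ x - G₀ x * (∫ y, G₀ y ∂(κ h x))) μ := hi3.sub hi4
  rw [integral_add hi34 hi5, integral_const_mul,
    integral_sub (integrable_of_continuous_of_compactSpace hG₀c μ) (integrable_of_continuous_of_compactSpace hκG₀c μ),
    hG₀0, hκG₀0, sub_self, mul_zero, add_zero]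

/-- ★ **Discrete log-convexity of `u ↦ Φ_F(u) = ∫ F κ_u F dμ_{β'}` on a grid**: `Φ((n+1)T)² ≤ Φ(nT) Φ((n+2)T)` (g15's midpoint
Cauchy–Schwarz `sq_integral_mul_transition_le` at `s = nT/2`, `t = (n+2)T/2`). [cite: BakryGentilLedoux2014, Lemma 4.2.6] -/
theorem integral_mul_transition_succ_ratio (L : ℕ) [NeZero L] (β' : ℝ)
    (κ : ℝ≥0 → Kernel (GaugeConfig 3 L (Matrix.specialUnitaryGroup (Fin 2) ℂ))
      (GaugeConfig 3 L (Matrix.specialUnitaryGroup (Fin 2) ℂ))) [∀ t, IsMarkovKernel (κ t)]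
    (hreal : ∀ (t : ℝ≥0) (x : GaugeConfig 3 L (Matrix.specialUnitaryGroup (Fin 2) ℂ))
        (Ω : Type) [MeasurableSpace Ω] (P : Measure Ω) [IsProbabilityMeasure P]
        (W : ℝ≥0 → Ω → (Edge 3 L × NoiseIdx 2 → ℝ)) (hW : IsFlatBrownian W P)
        (U : ℝ≥0 → Ω → GaugeConfig 3 L (Matrix.specialUnitaryGroup (Fin 2) ℂ)),
        (∀ ω, U 0 ω = x) →
        (latticeLangevinDynamics (fundamentalLatticeRep 2) β').IsSolution (fundamentalRep (Fin 2))
          hW.natFiltration P W U →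
        κ t x = P.map (U t))
    (T : ℝ≥0) {F : GaugeConfig 3 L (Matrix.specialUnitaryGroup (Fin 2) ℂ) → ℝ} (hF : Continuous F) (n : ℕ) :
    (∫ x, F x * (∫ y, F y ∂(κ (((n : ℝ≥0) + 1) * T) x)) ∂(wilsonMeasure (d := 3) (L := L) (fundamentalRep (Fin 2)) β')) ^ 2 ≤
      (∫ x, F x * (∫ y, F y ∂(κ ((n : ℝ≥0) * T) x)) ∂(wilsonMeasure (d := 3) (L := L) (fundamentalRep (Fin 2)) β')) *
        ∫ x, F x * (∫ y, F y ∂(κ (((n : ℝ≥0) + 2) * T) x)) ∂(wilsonMeasure (d := 3) (L := L) (fundamentalRep (Fin 2)) β') := by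
  have h := sq_integral_mul_transition_le L β' κ hreal ((n : ℝ≥0) * T / 2) (((n : ℝ≥0) + 2) * T / 2) hF
  have e1 : (n : ℝ≥0) * T / 2 + ((n : ℝ≥0) + 2) * T / 2 = ((n : ℝ≥0) + 1) * T := by
    apply NNReal.eq; push_cast; ring
  have e2 : (n : ℝ≥0) * T / 2 + (n : ℝ≥0) * T / 2 = (n : ℝ≥0) * T := add_halves _
  have e3 : ((n : ℝ≥0) + 2) * T / 2 + ((n : ℝ≥0) + 2) * T / 2 = ((n : ℝ≥0) + 2) * T := add_halves _
  rw [e1, e2, e3] at h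
  exact h

/-- ★ **The first ratio is the smallest**: if `Φ(0) = ∫ F² dμ_{β'} > 0` then `Φ(nT) ≥ Φ(0) · (Φ(T)/Φ(0))^n` for every `n` (the
ratios `Φ((k+1)T)/Φ(kT)` of the log-convex, non-increasing sequence `Φ(kT)` do not decrease). [folklore] -/
theorem integral_mul_transition_nat_mul_ge (L : ℕ) [NeZero L] (β' : ℝ)
    (κ : ℝ≥0 → Kernel (GaugeConfig 3 L (Matrix.specialUnitaryGroup (Fin 2) ℂ))
      (GaugeConfig 3 L (Matrix.specialUnitaryGroup (Fin 2) ℂ))) [∀ t, IsMarkovKernel (κ t)]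
    (hreal : ∀ (t : ℝ≥0) (x : GaugeConfig 3 L (Matrix.specialUnitaryGroup (Fin 2) ℂ))
        (Ω : Type) [MeasurableSpace Ω] (P : Measure Ω) [IsProbabilityMeasure P]
        (W : ℝ≥0 → Ω → (Edge 3 L × NoiseIdx 2 → ℝ)) (hW : IsFlatBrownian W P)
        (U : ℝ≥0 → Ω → GaugeConfig 3 L (Matrix.specialUnitaryGroup (Fin 2) ℂ)),
        (∀ ω, U 0 ω = x) →
        (latticeLangevinDynamics (fundamentalLatticeRep 2) β').IsSolution (fundamentalRep (Fin 2))
          hW.natFiltration P W U →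
        κ t x = P.map (U t))
    (T : ℝ≥0) {F : GaugeConfig 3 L (Matrix.specialUnitaryGroup (Fin 2) ℂ) → ℝ} (hF : Continuous F)
    (h0 : 0 < ∫ x, F x * F x ∂(wilsonMeasure (d := 3) (L := L) (fundamentalRep (Fin 2)) β')) (n : ℕ) :
    (∫ x, F x * F x ∂(wilsonMeasure (d := 3) (L := L) (fundamentalRep (Fin 2)) β')) *
        ((∫ x, F x * (∫ y, F y ∂(κ T x)) ∂(wilsonMeasure (d := 3) (L := L) (fundamentalRep (Fin 2)) β')) /
          ∫ x, F x * F x ∂(wilsonMeasure (d := 3) (L := L) (fundamentalRep (Fin 2)) β')) ^ n ≤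
      ∫ x, F x * (∫ y, F y ∂(κ ((n : ℝ≥0) * T) x)) ∂(wilsonMeasure (d := 3) (L := L) (fundamentalRep (Fin 2)) β') := by
  classical
  set μ : Measure (GaugeConfig 3 L (Matrix.specialUnitaryGroup (Fin 2) ℂ)) :=
    wilsonMeasure (d := 3) (L := L) (fundamentalRep (Fin 2)) β' with hμ
  set a : ℕ → ℝ := fun k => ∫ x, F x * (∫ y, F y ∂(κ ((k : ℝ≥0) * T) x)) ∂μ with ha
  have hκ0 : κ 0 = Kernel.id := transitionKernel_zero_eq_id L β' κ hreal
  have ha0 : a 0 = ∫ x, F x * F x ∂μ := by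
    simp only [ha, Nat.cast_zero, zero_mul, hκ0, Kernel.id_apply, integral_dirac]
  have ha1 : a 1 = ∫ x, F x * (∫ y, F y ∂(κ T x)) ∂μ := by
    simp only [ha, Nat.cast_one, one_mul]
  have hnn : ∀ k, 0 ≤ a k := fun k => integral_mul_transition_self_nonneg L β' κ hreal _ hF
  -- antitone along the grid
  have hanti : ∀ k, a (k + 1) ≤ a k := by
    intro k
    have h := integral_mul_transition_self_antitone L β' κ hreal ((k : ℝ≥0) * T) T hF
    have e : (k : ℝ≥0) * T + T = (((k + 1 : ℕ) : ℝ≥0)) * T := by push_cast; ring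
    rw [e] at h
    exact h
  -- log-convexity along the grid
  have hlc : ∀ k, a (k + 1) ^ 2 ≤ a k * a (k + 2) := by
    intro k
    have h := integral_mul_transition_succ_ratio L β' κ hreal T hF k
    have e1 : ((k : ℝ≥0) + 1) * T = ((k + 1 : ℕ) : ℝ≥0) * T := by push_cast; ring
    have e2 : ((k : ℝ≥0) + 2) * T = ((k + 2 : ℕ) : ℝ≥0) * T := by push_cast; ring
    rw [e1, e2] at h
    exact h
  -- ratio monotonicity `a (k+1) · a 0 ≥ a k · a 1`
  have hratio : ∀ k, a k * a 1 ≤ a (k + 1) * a 0 := by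
    intro k
    induction k with
    | zero => rw [mul_comm]
    | succ k ih =>
      -- from `a(k+1)² ≤ a k · a(k+2)` and `a k · a 1 ≤ a(k+1) · a 0`
      rcases (hnn (k + 1)).lt_or_eq with hpos | hzero
      · have hk : 0 < a k := lt_of_lt_of_le hpos (hanti k)
        -- a(k+2) ≥ a(k+1)²/a k and a(k+1)/a k ≥ a 1/a 0
        have h1 : a (k + 1) * a 1 * a k ≤ a (k + 1) * (a (k + 1) * a 0) := by
          have := mul_le_mul_of_nonneg_left ih hpos.le
          linarith [this]
        have h2 : a (k + 1) * (a (k + 1) * a 0) = a (k + 1) ^ 2 * a 0 := by ring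
        have h3 : a (k + 1) ^ 2 * a 0 ≤ a k * a (k + 2) * a 0 :=
          mul_le_mul_of_nonneg_right (hlc k) (hnn 0)
        have h4 : a (k + 1) * a 1 * a k ≤ (a (k + 2) * a 0) * a k := by nlinarith [h1, h2, h3]
        exact le_of_mul_le_mul_right h4 hk
      · rw [← hzero, zero_mul]
        exact mul_nonneg (hnn _) (hnn 0)
  -- conclusion by induction
  have h0' : 0 < a 0 := by rw [ha0]; exact h0
  have key : ∀ k, a 0 * (a 1 / a 0) ^ k ≤ a k := by
    intro k
    induction k with
    | zero => simp
    | succ k ih =>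
      have hq : 0 ≤ a 1 / a 0 := div_nonneg (hnn 1) h0'.le
      have hstep : a k * (a 1 / a 0) ≤ a (k + 1) := by
        rw [mul_div_assoc', div_le_iff₀ h0']
        exact hratio k
      calc a 0 * (a 1 / a 0) ^ (k + 1) = (a 0 * (a 1 / a 0) ^ k) * (a 1 / a 0) := by rw [pow_succ]; ring
        _ ≤ a k * (a 1 / a 0) := mul_le_mul_of_nonneg_right ih hq
        _ ≤ a (k + 1) := hstep
  have h := key n
  rw [ha0, ha1] at h
  exact h

/-- **Riemann lower sum of the non-increasing autocorrelation function**: for continuous `F` and a grid `T`,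
`T · Σ_{k<N} Φ((k+1)T) ≤ ∫₀^{NT} Φ(t) dt` with `Φ(t) = ∫ F κ_t F dμ_{β'}` (antitone, `integral_mul_transition_self_antitone`). [folklore] -/
theorem mul_sum_le_intervalIntegral_autocorrelation (L : ℕ) [NeZero L] (β' : ℝ)
    (κ : ℝ≥0 → Kernel (GaugeConfig 3 L (Matrix.specialUnitaryGroup (Fin 2) ℂ))
      (GaugeConfig 3 L (Matrix.specialUnitaryGroup (Fin 2) ℂ))) [∀ t, IsMarkovKernel (κ t)]
    (hreal : ∀ (t : ℝ≥0) (x : GaugeConfig 3 L (Matrix.specialUnitaryGroup (Fin 2) ℂ))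
        (Ω : Type) [MeasurableSpace Ω] (P : Measure Ω) [IsProbabilityMeasure P]
        (W : ℝ≥0 → Ω → (Edge 3 L × NoiseIdx 2 → ℝ)) (hW : IsFlatBrownian W P)
        (U : ℝ≥0 → Ω → GaugeConfig 3 L (Matrix.specialUnitaryGroup (Fin 2) ℂ)),
        (∀ ω, U 0 ω = x) →
        (latticeLangevinDynamics (fundamentalLatticeRep 2) β').IsSolution (fundamentalRep (Fin 2))
          hW.natFiltration P W U →
        κ t x = P.map (U t))
    (T : ℝ≥0) {F : GaugeConfig 3 L (Matrix.specialUnitaryGroup (Fin 2) ℂ) → ℝ} (hF : Continuous F) (N : ℕ) :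
    (T : ℝ) * ∑ k ∈ Finset.range N,
        ∫ x, F x * (∫ y, F y ∂(κ (((k : ℝ≥0) + 1) * T) x)) ∂(wilsonMeasure (d := 3) (L := L) (fundamentalRep (Fin 2)) β') ≤
      ∫ t in (0 : ℝ)..((N : ℝ) * T),
        ∫ x, F x * (∫ y, F y ∂(κ t.toNNReal x)) ∂(wilsonMeasure (d := 3) (L := L) (fundamentalRep (Fin 2)) β') := by
  classical
  set μ : Measure (GaugeConfig 3 L (Matrix.specialUnitaryGroup (Fin 2) ℂ)) :=
    wilsonMeasure (d := 3) (L := L) (fundamentalRep (Fin 2)) β' with hμ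
  set φ : ℝ → ℝ := fun t => ∫ x, F x * (∫ y, F y ∂(κ t.toNNReal x)) ∂μ with hφ
  have hφc : Continuous φ := (continuous_integral_mul_transition L β' κ hreal hF hF).comp continuous_real_toNNReal
  -- antitone in real time on `[0, ∞)`
  have hφanti : ∀ {t t' : ℝ}, 0 ≤ t → t ≤ t' → φ t' ≤ φ t := by
    intro t t' ht htt'
    have e : t'.toNNReal = t.toNNReal + (t' - t).toNNReal := by
      rw [← Real.toNNReal_add ht (by linarith)]; congr 1; ring
    simp only [hφ, e]
    exact integral_mul_transition_self_antitone L β' κ hreal _ _ hF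
  have hT0 : (0 : ℝ) ≤ T := T.2
  induction N with
  | zero => simp
  | succ N ih =>
    rw [Finset.sum_range_succ, mul_add]
    have hsplit : ∫ t in (0 : ℝ)..(((N + 1 : ℕ) : ℝ) * T), φ t =
        (∫ t in (0 : ℝ)..((N : ℝ) * T), φ t) + ∫ t in ((N : ℝ) * T)..(((N + 1 : ℕ) : ℝ) * T), φ t :=
      (intervalIntegral.integral_add_adjacent_intervals (hφc.intervalIntegrable _ _) (hφc.intervalIntegrable _ _)).symm
    rw [hsplit]
    refine add_le_add ih ?_
    -- on `[NT, (N+1)T]` the integrand is at least its value at the right end point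
    have hle : (N : ℝ) * T ≤ ((N + 1 : ℕ) : ℝ) * T := by
      push_cast; nlinarith
    have hend : φ (((N + 1 : ℕ) : ℝ) * T) = ∫ x, F x * (∫ y, F y ∂(κ (((N : ℝ≥0) + 1) * T) x)) ∂μ := by
      have e : ((((N + 1 : ℕ) : ℝ) * T).toNNReal) = ((N : ℝ≥0) + 1) * T := by
        apply NNReal.eq
        rw [Real.coe_toNNReal _ (by positivity)]
        push_cast; ring
      simp only [hφ, e]
    have hconst : ∫ t in ((N : ℝ) * T)..(((N + 1 : ℕ) : ℝ) * T), φ (((N + 1 : ℕ) : ℝ) * T) =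
        (T : ℝ) * φ (((N + 1 : ℕ) : ℝ) * T) := by
      rw [intervalIntegral.integral_const, smul_eq_mul]
      congr 1; push_cast; ring
    rw [← hend, ← hconst]
    refine intervalIntegral.integral_mono_on hle intervalIntegrable_const (hφc.intervalIntegrable _ _) ?_
    intro t ht
    exact hφanti (le_trans (by positivity) ht.1) ht.2

end Summit.QuantumFields.YangMills.Theorems.ColdStartUniversality

end
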